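import Summits.BirchSwinnertonDyer.BirchSwinnertonDyer.Theorems.ManinLocalTwoThreeNewformFortyTrace
import Literature.NumberTheory.EllipticCurves.NewformsOldNewProofs
import Literature.NumberTheory.EllipticCurves.ModularFormsGamma0Genus
import HarnessLib

/-!
# Level 40 (`2³·5`, genus `3`), newform part 2: the newform of every `X₀(40)`-datum is `φ₄₀ = g₁ − 2g₂` — FACT-FREE newform
# pinning WITHOUT a `U₂`-computation — and the cuspidal Sturm bound at level `40`

Cell bsd-f2-manin, route `ManinLocalTwoThree` (crux C2 `ManinOddAtFour`, stmt-22967), prover seat p2 gen 27; sequel to `…NewformForty` / `…NewformFortyTrace`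
(`g₁ = η₂⁵η₅²η₂₀/(η₁²η₄η₁₀)`, `g₂ = η₄²η₂₀²`, `φ₄₀ = g₁ − 2g₂`; the trace `Tr : S₂(Γ₀(40)) → S₂(Γ₀(20))` kills `g₁`, `g₂`, `φ₄₀`;
`a₁(φ₄₀) = 1`, `a₂(φ₄₀) = 0`, `a₁(g₂) = 0`, `a₂(g₂) = 1`).

* §4 `μ(40) = 72`, `ν_∞ = 8`, `ν₂ = ν₃ = 0`, `g(X₀(40)) = 3 = dim S₂(Γ₀(40))` (tree `finrank_cuspForm_two_eq_genusX0_holds`).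
* §5 `Tr(ι₁f₂₀) = 2f₂₀ ≠ 0` (`f₂₀|W = f₂₀` for `W = (1 0; 20 1) ∈ Γ₀(20)`), so `dim ker Tr ≤ 2`; `φ₄₀`, `g₂ ∈ ker Tr` are independent
  (orders `1`, `2` at `∞`), so **`ker Tr = ℂφ₄₀ ⊕ ℂg₂`** and every `g` with `Tr g = 0` is `αφ₄₀ + βg₂`.
* §6 A newform `g` of level `40` lies in `S₂(Γ₀(40))^{new} ⊆ ker Tr`; `a₁(g) = 1` gives `α = 1` and `a₂(g) = 0` (`4 ∣ 40`, tree
  `IsNewform0.cuspCoeff_eq_zero_of_sq_dvd`, Atkin–Lehner Thm. 3) gives `β = 0`: **every newform of level `40` is `φ₄₀`, so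
  `D.f = φ₄₀` for every `X₀(40)`-datum `D` of every curve** (`f_apply_eq_phi40`) — fact-free, and with no computation of `U₂φ₄₀`.
* §7 The cuspidal Sturm bound at level `40` (tree `coe_eq_zero_of_isBigO_exp`: `⌊2·72/12⌋ + 1 = 13 < 6 + 8`): `S ∈ S₂(Γ₀(40))` with
  `S/q⁶` convergent at `i∞` vanishes (the vanishing criterion for the `η`-identities at `40`).

No definition, no named fact, no sorry.  Nothing here proves C2, Manin's conjecture or BSD.
[cite: AtkinLehner1970, Thm. 3, Thm. 5] [cite: DiamondShurman2005, §5.6, Thm. 3.5.1] [cite: CremonaAlgorithms1997, Table 3 (N = 40)]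
-/

set_option autoImplicit false
-- lint-debt: the directory name repeats the summit name (sibling precedent `ManinLocalTwoThreeNewformForty.lean`)
set_option linter.dupNamespace false

noncomputable section

open Complex Filter Topology Set Function Asymptotics Polynomial
open UpperHalfPlane hiding I
open scoped Real Topology Manifold MatrixGroups ModularForm
open ModularForm CongruenceSubgroup Matrix.SpecialLinearGroup
open Literature.NumberTheory.ModularForms
open Literature.NumberTheory.EllipticCurves Literature.NumberTheory.EllipticCurves.ModularForms

namespace Summit.BirchSwinnertonDyer.BirchSwinnertonDyer.Theorems.ManinLocalTwoThree.NewformForty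

open CuspToolkit QRemainder
open NewformFortyEight (slash_mapGL)

/-! ## §4 `dim S₂(Γ₀(40)) = g(X₀(40)) = 3` -/

/-- `μ(Γ₀(40)) = 72`, `ν_∞ = 8`, `ν₂ = ν₃ = 0` (Diamond–Shurman §3.8). [cite: DiamondShurman2005, §3.8] -/
theorem gamma0_data_40 : gamma0Index 40 = 72 ∧ nuInfty 40 = 8 ∧ nu₂ 40 = 0 ∧ nu₃ 40 = 0 :=
  ⟨(gamma0Index_mul (m := 8) (n := 5) (by norm_num)).trans
      (by rw [show (8 : ℕ) = 2 ^ 3 by norm_num, gamma0Index_prime_pow (p := 2) (e := 3) Nat.prime_two (by norm_num),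
        gamma0Index_prime Nat.prime_five]; norm_num),
    by decide, by rw [nu₂_eq_card]; decide, by rw [nu₃_eq_card]; decide⟩

/-- `g(X₀(40)) = 3`. [cite: DiamondShurman2005, Thm. 3.1.1] -/
theorem genusX0_forty : genusX0 40 = 3 := by
  obtain ⟨h1, h2, h3, h4⟩ := gamma0_data_40
  rw [genusX0, h1, h2, h3, h4]

/-- **`dim S₂(Γ₀(40)) = 3`.** [cite: DiamondShurman2005, Thm. 3.5.1] -/
theorem finrank_cuspForm_two_forty : Module.finrank ℂ (CuspForm (Gamma0 40) 2) = 3 := by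
  have h := finrank_cuspForm_two_eq_genusX0_holds 40
  unfold finrank_cuspForm_two_eq_genusX0 at h
  rw [h, genusX0_forty]

/-! ## §5 The trace is non-zero; `ker Tr = ℂφ₄₀ ⊕ ℂg₂` -/

/-- **`Tr(ι₁f₂₀) = 2·f₂₀`**: the trace `S₂(Γ₀(40)) → S₂(Γ₀(20))` of the level-`20` form `f₂₀ = η₂²η₁₀²` viewed at level `40`
(`ι₁f₂₀ = f₂₀` pointwise, `f₂₀ + f₂₀|W = 2f₂₀` as `W = (1 0; 20 1) ∈ Γ₀(20)`). [cite: DiamondShurman2005, §5.6] -/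
theorem adjDegeneracyMap0_one_degeneracyMap0_one_f20 :
    adjDegeneracyMap0 40 20 1 2 (degeneracyMap0 20 40 1 2 cuspFormEtaProductTwenty) = (2 : ℂ) • cuspFormEtaProductTwenty := by
  haveI : Fact (Nat.Prime 2) := ⟨Nat.prime_two⟩
  have hι := coe_degeneracyMap0_one 20 40 2 (by norm_num) cuspFormEtaProductTwenty
  have h := coe_adjDegeneracyMap0_one_eq_sum 2 2 20 40 (by norm_num) (by norm_num) (degeneracyMap0 20 40 1 2 cuspFormEtaProductTwenty)
  apply DFunLike.ext
  intro τ
  have hτ := congr_fun h τ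
  rw [Finset.sum_apply, Fin.sum_univ_two, hι] at hτ
  rw [CuspForm.IsGLPos.smul_apply, smul_eq_mul, hτ]
  have h0 : (Matrix.SpecialLinearGroup.transpose (ModularGroup.T ^ ((20 : ℕ) * (((0 : Fin 2) : ℕ) : ℤ) : ℤ))
      : SL(2, ℤ)) = 1 := by
    ext i j
    fin_cases i <;> fin_cases j <;>
      simp [Matrix.SpecialLinearGroup.transpose]
  set X : SL(2, ℤ) := Matrix.SpecialLinearGroup.transpose (ModularGroup.T ^ ((20 : ℕ) * (((1 : Fin 2) : ℕ) : ℤ) : ℤ))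
    with hX
  have hX' : ∀ i j : Fin 2, X i j = !![(1 : ℤ), 0; 20, 1] i j := by
    intro i j
    rw [hX]
    fin_cases i <;> fin_cases j <;>
      simp [Matrix.SpecialLinearGroup.transpose, ModularGroup.coe_T_zpow]
  have h10 : X 1 0 = 20 := by simpa using hX' 1 0
  have hW : (⇑cuspFormEtaProductTwenty ∣[(2 : ℤ)] (Matrix.SpecialLinearGroup.mapGL ℝ X : GL (Fin 2) ℝ)) = ⇑cuspFormEtaProductTwenty :=
    SlashInvariantForm.slash_action_eqn cuspFormEtaProductTwenty _ ⟨X, mem_Gamma0_twenty_of_entries X h10, rfl⟩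
  rw [h0, map_one, SlashAction.slash_one, hW]
  ring

/-- **`dim ker Tr ≤ 2`** (`dim S₂(Γ₀(40)) = 3` and `Tr ≠ 0`). [cite: DiamondShurman2005, §5.6] -/
theorem finrank_ker_adjDegeneracyMap0_one_le_two :
    Module.finrank ℂ (LinearMap.ker (adjDegeneracyMap0 40 20 1 2)) ≤ 2 := by
  haveI : FiniteDimensional ℂ (CuspForm (Gamma0 40) 2) := finiteDimensional_cuspForm_gamma0 40 2
  haveI : FiniteDimensional ℂ (CuspForm (Gamma0 20) 2) := finiteDimensional_cuspForm_gamma0 20 2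
  have hsum := LinearMap.finrank_range_add_finrank_ker (adjDegeneracyMap0 40 20 1 2)
  rw [finrank_cuspForm_two_forty] at hsum
  have hrange : 1 ≤ Module.finrank ℂ (LinearMap.range (adjDegeneracyMap0 40 20 1 2)) := by
    by_contra hlt
    have h0 : Module.finrank ℂ (LinearMap.range (adjDegeneracyMap0 40 20 1 2)) = 0 := by omega
    rw [Submodule.finrank_eq_zero] at h0
    have hmem : adjDegeneracyMap0 40 20 1 2 (degeneracyMap0 20 40 1 2 cuspFormEtaProductTwenty)
        ∈ LinearMap.range (adjDegeneracyMap0 40 20 1 2) := LinearMap.mem_range_self _ _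
    rw [h0, Submodule.mem_bot, adjDegeneracyMap0_one_degeneracyMap0_one_f20] at hmem
    rcases smul_eq_zero.mp hmem with h2 | hf
    · norm_num at h2
    · exact cuspFormEtaProductTwenty_ne_zero hf
  omega

section Phi

variable (φ G : CuspForm (Gamma0 40) 2)
  (hφ : ⇑φ = fun τ ↦ etaQuotient 40 (expFn [(1, -2), (2, 5), (4, -1), (5, 2), (10, -1), (20, 1)]) τ
      - 2 * etaQuotient 40 (expFn [(4, 2), (20, 2)]) τ)
  (hG : ⇑G = etaQuotient 40 (expFn [(4, 2), (20, 2)]))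
include hφ hG

/-- **`φ₄₀` and `g₂` are linearly independent** (orders `1` and `2` at `∞`). [folklore] -/
theorem linearIndependent_phi40_g2 : LinearIndependent ℂ ![φ, G] := by
  refine linearIndependent_of_tendsto_div_qParam_zpow ![φ, G] ![1, 2] (fun i j h ↦ ?_) (fun i ↦ ?_)
  · fin_cases i <;> fin_cases j <;> simp_all
  · fin_cases i
    · show Tendsto (fun τ : ℍ ↦ φ τ / Function.Periodic.qParam 1 (τ : ℂ) ^ (1 : ℤ)) atImInfty (𝓝 1)
      simpa only [zpow_one] using tendsto_phi40_div_qParam φ hφ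
    · show Tendsto (fun τ : ℍ ↦ G τ / Function.Periodic.qParam 1 (τ : ℂ) ^ (2 : ℤ)) atImInfty (𝓝 1)
      rw [hG]
      exact tendsto_g2_div_qParam_sq

/-- **Every `g ∈ ker Tr` is `αφ₄₀ + βg₂`** (`φ₄₀, g₂ ∈ ker Tr` independent, `dim ker Tr ≤ 2`). [cite: AtkinLehner1970, Thm. 5] -/
theorem exists_eq_combination_of_adjDegeneracyMap0_one_eq_zero {g : CuspForm (Gamma0 40) 2}
    (hg : adjDegeneracyMap0 40 20 1 2 g = 0) : ∃ α β : ℂ, α • φ + β • G = g := by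
  haveI : FiniteDimensional ℂ (CuspForm (Gamma0 40) 2) := finiteDimensional_cuspForm_gamma0 40 2
  have hnot : ¬ LinearIndependent ℂ (Fin.cons g ![φ, G] : Fin 3 → CuspForm (Gamma0 40) 2) := by
    intro hli
    have h3 : Module.finrank ℂ (Submodule.span ℂ (Set.range (Fin.cons g ![φ, G] : Fin 3 → CuspForm (Gamma0 40) 2))) = 3 := by
      rw [finrank_span_eq_card hli, Fintype.card_fin]
    have hle : Submodule.span ℂ (Set.range (Fin.cons g ![φ, G] : Fin 3 → CuspForm (Gamma0 40) 2))
        ≤ LinearMap.ker (adjDegeneracyMap0 40 20 1 2) := by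
      rw [Submodule.span_le]
      rintro _ ⟨i, rfl⟩
      rw [SetLike.mem_coe, LinearMap.mem_ker]
      fin_cases i
      · exact hg
      · exact adjDegeneracyMap0_one_phi40 φ hφ
      · exact adjDegeneracyMap0_one_g2 G hG
    have hmono := Submodule.finrank_mono hle
    have h2 := finrank_ker_adjDegeneracyMap0_one_le_two
    omega
  rw [linearIndependent_finCons, not_and, not_not] at hnot
  have hmem : g ∈ Submodule.span ℂ (Set.range ![φ, G]) := hnot (linearIndependent_phi40_g2 φ G hφ hG)
  obtain ⟨c, hc⟩ := (Submodule.mem_span_range_iff_exists_fun ℂ).mp hmem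
  refine ⟨c 0, c 1, ?_⟩
  rw [Fin.sum_univ_two] at hc
  simpa using hc

/-! ## §6 Newform pinning at level `40` -/

/-- **Every newform of weight `2` on `Γ₀(40)` is `φ₄₀`** — FACT-FREE, without computing `U₂φ₄₀` (`g ∈ new ⊆ ker Tr`,
`g = αφ₄₀ + βg₂`, `a₁`: `α = 1`, `a₂(g) = 0` as `4 ∣ 40`: `β = 0`). [cite: CremonaAlgorithms1997, Table 3 (N = 40)] -/
theorem eq_phi40_of_isNewform0 {g : CuspForm (Gamma0 40) 2} (hg : IsNewform0 g) : g = φ := by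
  have hker : adjDegeneracyMap0 40 20 1 2 g = 0 := by
    have h := (Submodule.mem_iInf _).mp hg.1 ⟨(20, 1), by decide, by decide⟩
    exact LinearMap.mem_ker.mp h
  obtain ⟨α, β, hαβ⟩ := exists_eq_combination_of_adjDegeneracyMap0_one_eq_zero φ G hφ hG hker
  have hΓ := one_mem_strictPeriods_coe_gamma0 40
  have h1 : cuspCoeff g 1 = 1 := hg.2.2
  have h2 : cuspCoeff g 2 = 0 := hg.cuspCoeff_eq_zero_of_sq_dvd Nat.prime_two ⟨10, by norm_num⟩
  obtain ⟨hφ1, hφ2⟩ := cuspCoeff_phi40 φ hφ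
  obtain ⟨hG1, hG2⟩ := cuspCoeff_g2 G hG
  rw [← hαβ, cuspCoeff_add_form hΓ, cuspCoeff_smul, cuspCoeff_smul, hφ1, hG1] at h1
  rw [← hαβ, cuspCoeff_add_form hΓ, cuspCoeff_smul, cuspCoeff_smul, hφ2, hG2] at h2
  have hα : α = 1 := by simpa using h1
  have hβ : β = 0 := by simpa using h2
  rw [← hαβ, hα, hβ, one_smul, zero_smul, add_zero]

omit hG in
/-- **Every `X₀(40)`-datum of every curve has newform `φ₄₀`** (as cusp forms). FACT-FREE. [cite: CremonaAlgorithms1997, Table 3 (N = 40)] -/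
theorem f_eq_phi40 {W : WeierstrassCurve ℚ} (D : ModularParametrizationData W 40) : D.f = φ := by
  obtain ⟨G₂, hG₂⟩ := exists_cuspForm_g2
  exact eq_phi40_of_isNewform0 φ G₂ hφ hG₂ D.isNewformOf.1

end Phi

/-- **Every `X₀(40)`-datum of every curve has newform `φ₄₀ = η₂⁵η₅²η₂₀/(η₁²η₄η₁₀) − 2η₄²η₂₀²`** (pointwise, definition-free form).
FACT-FREE. [cite: CremonaAlgorithms1997, Table 3 (N = 40)] -/
theorem f_apply_eq_phi40 {W : WeierstrassCurve ℚ} (D : ModularParametrizationData W 40) :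
    ⇑D.f = fun τ ↦ etaQuotient 40 (expFn [(1, -2), (2, 5), (4, -1), (5, 2), (10, -1), (20, 1)]) τ
      - 2 * etaQuotient 40 (expFn [(4, 2), (20, 2)]) τ := by
  obtain ⟨φ, hφ⟩ := exists_cuspForm_phi40
  rw [f_eq_phi40 φ hφ D, hφ]

/-- **Non-emptiness transfer**: if some curve has an `X₀(40)`-datum then `φ₄₀ ∈ S₂(Γ₀(40))^{new}` (it IS the datum's newform).
[cite: AtkinLehner1970, Thm. 5] -/
theorem mem_newSubspace0_of_datum (φ : CuspForm (Gamma0 40) 2)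
    (hφ : ⇑φ = fun τ ↦ etaQuotient 40 (expFn [(1, -2), (2, 5), (4, -1), (5, 2), (10, -1), (20, 1)]) τ
      - 2 * etaQuotient 40 (expFn [(4, 2), (20, 2)]) τ)
    {W : WeierstrassCurve ℚ} (D : ModularParametrizationData W 40) : φ ∈ newSubspace0 40 2 := by
  rw [← f_eq_phi40 φ hφ D]
  exact D.isNewformOf.1.1

/-! ## §7 The cuspidal Sturm bound at level `40`: `S = O(q⁶) ⟹ S = 0` -/

/-- **`S ∈ S₂(Γ₀(40))` with `S = O(e^{−12π Im τ})` at `i∞` vanishes** (`⌊2·72/12⌋ + 1 = 13 < 6 + 8`).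
[cite: DiamondShurman2005, Thm. 3.5.1] -/
theorem cuspForm_forty_eq_zero_of_isBigO (S : CuspForm (Gamma0 40) 2)
    (h : (⇑S) =O[atImInfty] fun τ : ℍ ↦ Real.exp (-2 * π * 6 * τ.im)) : S = 0 := by
  have hcard : Nat.card (𝒮ℒ ⧸ ((Gamma0 40 : Subgroup SL(2, ℤ)) : Subgroup (GL (Fin 2) ℝ)).subgroupOf 𝒮ℒ) = 72 := by
    rw [card_quotient_subgroupOf_eq_index]
    have h1 := index_gamma0_eq_gamma0Index_holds 40
    unfold index_gamma0_eq_gamma0Index at h1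
    rw [h1, gamma0_data_40.1]
  have hcusp : Nat.card (CuspOrbits ((Gamma0 40 : Subgroup SL(2, ℤ)) : Subgroup (GL (Fin 2) ℝ))) = 8 := by
    have h1 := numCusps_eq_nuInfty_holds 40
    unfold numCusps_eq_nuInfty numCusps at h1
    rw [h1, gamma0_data_40.2.1]
  have h0 := coe_eq_zero_of_isBigO_exp S h (by
    rw [hcard, hcusp]
    simp only [Int.reduceMul, Int.reduceToNat, Nat.reduceDiv, Nat.cast_ofNat]
    norm_num)
  exact DFunLike.ext' (h0.trans CuspForm.coe_zero.symm)

/-- **`S ∈ S₂(Γ₀(40))` with `S/q⁶` convergent at `i∞` vanishes.** [cite: DiamondShurman2005, Thm. 3.5.1] -/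
theorem cuspForm_forty_eq_zero_of_tendsto (S : CuspForm (Gamma0 40) 2) {c : ℂ}
    (h : Tendsto (fun τ : ℍ ↦ S τ / Periodic.qParam 1 (τ : ℂ) ^ 6) atImInfty (𝓝 c)) : S = 0 := by
  refine cuspForm_forty_eq_zero_of_isBigO S ?_
  have h1 : (fun τ : ℍ ↦ S τ / Periodic.qParam 1 (τ : ℂ) ^ 6) =O[atImInfty] fun _ : ℍ ↦ (1 : ℝ) :=
    h.isBigO_one ℝ
  have h2 : (fun τ : ℍ ↦ Periodic.qParam 1 (τ : ℂ) ^ 6) =O[atImInfty] fun τ : ℍ ↦ Real.exp (-2 * π * 6 * τ.im) := by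
    refine Asymptotics.IsBigO.of_bound 1 (Filter.Eventually.of_forall fun τ ↦ ?_)
    rw [norm_pow, Periodic.norm_qParam, Real.norm_eq_abs, abs_of_pos (Real.exp_pos _), one_mul,
      ← Real.exp_nat_mul, UpperHalfPlane.coe_im]
    apply le_of_eq
    congr 1
    ring
  have h3 := h1.mul h2
  simp only [one_mul] at h3
  refine h3.congr' (Filter.Eventually.of_forall fun τ ↦ ?_) EventuallyEq.rfl
  have hq : Periodic.qParam 1 (τ : ℂ) ≠ 0 := Complex.exp_ne_zero _
  show S τ / Periodic.qParam 1 (τ : ℂ) ^ 6 * Periodic.qParam 1 (τ : ℂ) ^ 6 = S τ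
  rw [div_mul_cancel₀ _ (pow_ne_zero _ hq)]

end Summit.BirchSwinnertonDyer.BirchSwinnertonDyer.Theorems.ManinLocalTwoThree.NewformForty

end
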